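import Mathlib
import Summits.Ventures.PercRepro2.SwOutMultiRootEDefs

/-!
# The decorated multi-root core cube: the base, the units and the edge values (blind cell
PercRepro2, night-4 g35, 2026-08-29; proofs/NIGHT4-G35.md §3)

A BLUE-ESCAPING junction `u` of a class — `u ∈ C_B(l) ∖ C_R(l)`, the frontier of g34's (★)-fibration —
sits in a red arm of the multi-root core cube, and its blue route to `l` leaves the extended hull
through outside vertices.  THE DECORATED CUBE flips that route together with the arm: every arm
`A i` of a `MultiBaseE` carries a DECORATION `Z i` — a set of vertices outside `H ∪ {l}`, pairwise
disjoint, whose every edge goes to the arm `A i` (blue at the base, like every edge leaving `H`),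
stays inside `Z i`, or goes to `l` (either colour), and whose every vertex is blue-connected to `l`
by edges touching the unit `A i ∪ Z i` (`decoRoute`: the route).  A cube point flips the UNITS
assigned `false` and negates the root–root edges assigned `false`: `decoRealRR` is g34's
`coreRealRR` with the units as arms.  Census (mining/night-4/g35/shadow10.py, design 10): on the
uncovered mark-step classes of the open pairs after `mr5` the decorated cubes partition every fibre
of the escaping set, the side a lower set on each, Hall on each — `n = 6` 33 / 33 pairs, `n = 7`
3,562 / 4,868 pairs, 0 failures of the cube checks.

This file: the structure `DecoBaseE`, the unit facts (disjointness, no edge between two units, an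
edge at a root or a root–root edge never touches a decoration), and the value of a realisation on
every kind of edge; the avoidance lemmas are in SwOutShadowMultiRootAvoid.
-/

namespace Summit.Ventures.PercRepro2

namespace LocRows

open Hull

variable {V : Type*} {E : Type*}

open scoped Classical

variable {ends : E → Sym2 V}

section Route

variable (ends) in
/-- The blue edges of `ζ` touching the vertex set `S` (the route configuration of a unit). -/
noncomputable def decoRoute (S : Set V) (ζ : Config E) : Config E :=
  fun e => blue ζ e && decide (e ∈ touches ends S)

/-- Membership in the route configuration. -/
lemma decoRoute_eq_true_iff {S : Set V} {ζ : Config E} {e : E} :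
    decoRoute ends S ζ e = true ↔ ζ e = false ∧ e ∈ touches ends S := by
  simp [decoRoute, blue]

end Route

/-- **The data of a decorated multi-root core cube with root–root edges**: a `MultiBaseE` on the
hull part `(R, H, A)` together with a decoration `Z i` of every arm — outside `H`, not containing
`l`, pairwise disjoint; every edge at a vertex of `Z i` goes to `A i`, stays inside `Z i`, or goes
to `l`; every vertex of `Z i` is blue-connected to `l` by blue edges touching the unit
`A i ∪ Z i`. -/
structure DecoBaseE (ends : E → Sym2 V) (ζ : Config E) (R : Set V) (H : Set V) (l : V)
    {ι : Type*} (A Z : ι → Set V) (RR : Finset E) : Prop where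
  base : MultiBaseE ends ζ R H A RR
  l_notMem : l ∉ H
  deco_notMem : ∀ i, ∀ z ∈ Z i, z ∉ H
  deco_ne_l : ∀ i, l ∉ Z i
  deco_disj : ∀ i j, i ≠ j → ∀ z, z ∈ Z i → z ∉ Z j
  deco_edges : ∀ i, ∀ e z y, ends e = s(z, y) → z ∈ Z i → y ∈ A i ∨ y ∈ Z i ∨ y = l
  deco_conn : ∀ i, ∀ z ∈ Z i, z ∈ cluster ends (decoRoute ends (A i ∪ Z i) ζ) l

section Real

variable {ι : Type*} (A Z : ι → Set V) (RR : Finset E)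

/-- The unit of an arm: the arm with its decoration. -/
def unitAZ (i : ι) : Set V := A i ∪ Z i

variable (ends) in
/-- The realisation of a cube point of the decorated cube: the units assigned `false` flipped,
the root–root edges assigned `false` negated — g34's `coreRealRR` with the units as arms. -/
noncomputable def decoRealRR (ζ : Config E) (ω : Config (ι ⊕ ↥RR)) : Config E :=
  coreRealRR ends (unitAZ A Z) RR ζ ω

variable {A Z RR}

/-- Membership in a unit. -/
lemma mem_unitAZ {i : ι} {x : V} : x ∈ unitAZ A Z i ↔ x ∈ A i ∨ x ∈ Z i := Iff.rfl

/-- The realisation on a root–root edge. -/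
lemma decoRealRR_apply_rr {ζ : Config E} {ω : Config (ι ⊕ ↥RR)} {e : E} (he : e ∈ RR) :
    decoRealRR ends A Z RR ζ ω e = (if ω (Sum.inr ⟨e, he⟩) = true then ζ e else !ζ e) :=
  coreRealRR_apply_rr he

/-- The realisation off the root–root edges is the flip of the units assigned `false`. -/
lemma decoRealRR_apply_of_notMem_rr {ζ : Config E} {ω : Config (ι ⊕ ↥RR)} {e : E} (he : e ∉ RR) :
    decoRealRR ends A Z RR ζ ω e = flip ends (armsFalseC (unitAZ A Z) (armPart ω)) ζ e :=
  coreRealRR_apply_of_notMem_rr he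

end Real

section Base

variable {ι : Type*} {A Z : ι → Set V} {ζ : Config E} {R H : Set V} {l : V} {RR : Finset E}
  (hb : DecoBaseE ends ζ R H l A Z RR)
include hb

/-- A decoration vertex lies in no arm. -/
lemma DecoBaseE.deco_notMem_arm {i j : ι} {z : V} (hz : z ∈ Z i) : z ∉ A j :=
  fun h' => hb.deco_notMem i z hz (hb.base.arm_sub j z h').1

/-- A root lies in no unit. -/
lemma DecoBaseE.root_notMem_unit {r : V} (hr : r ∈ R) (i : ι) : r ∉ unitAZ A Z i := by
  rintro (h' | h')
  · exact hb.base.root_notMem_arm hr i h'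
  · exact hb.deco_notMem i r h' (hb.base.root_sub hr)

/-- `l` lies in no unit. -/
lemma DecoBaseE.l_notMem_unit (i : ι) : l ∉ unitAZ A Z i := by
  rintro (h' | h')
  · exact hb.l_notMem (hb.base.arm_sub i l h').1
  · exact hb.deco_ne_l i h'

/-- **Units are pairwise disjoint.** -/
lemma DecoBaseE.unit_disj {i j : ι} (hij : i ≠ j) {x : V} (hx : x ∈ unitAZ A Z i) :
    x ∉ unitAZ A Z j := by
  rintro (h' | h')
  · rcases hx with hx | hx
    · exact hb.base.arm_disj i j hij x hx h'
    · exact hb.deco_notMem_arm hx h'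
  · rcases hx with hx | hx
    · exact hb.deco_notMem_arm h' hx
    · exact hb.deco_disj i j hij x hx h'

/-- **The two ends of an edge in units lie in the same unit.** -/
lemma DecoBaseE.unit_eq_of_edge {i j : ι} {e : E} {x y : V} (hxy : ends e = s(x, y))
    (hx : x ∈ unitAZ A Z i) (hy : y ∈ unitAZ A Z j) : i = j := by
  rcases hx with hx | hx
  · rcases hy with hy | hy
    · exact hb.base.arm_eq_of_edge hxy hx hy
    · rcases hb.deco_edges j e y x (ends_swap hxy) hy with h' | h' | h'
      · by_contra hij
        exact hb.base.arm_disj i j hij x hx h'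
      · exact absurd hx (hb.deco_notMem_arm h')
      · exact absurd (hb.base.arm_sub i x hx).1 (h' ▸ hb.l_notMem)
  · rcases hb.deco_edges i e x y hxy hx with h' | h' | h'
    · rcases hy with hy | hy
      · by_contra hij
        exact hb.base.arm_disj i j hij y h' hy
      · exact absurd h' (hb.deco_notMem_arm hy)
    · rcases hy with hy | hy
      · exact absurd hy (hb.deco_notMem_arm h')
      · by_contra hij
        exact hb.deco_disj i j hij y h' hy
    · exact absurd hy (h' ▸ hb.l_notMem_unit j)

/-- An edge with an end in a unit is not a root–root edge. -/
lemma DecoBaseE.notMem_rr_of_mem_unit {e : E} {x y : V} (hxy : ends e = s(x, y)) {i : ι}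
    (hx : x ∈ unitAZ A Z i) : e ∉ RR := by
  intro he
  obtain ⟨r, hr, r', hr', hrr⟩ := (hb.base.rr_iff e).1 he
  rw [hxy, Sym2.eq_iff] at hrr
  rcases hrr with ⟨rfl, -⟩ | ⟨rfl, -⟩
  · exact hb.root_notMem_unit hr i hx
  · exact hb.root_notMem_unit hr' i hx

/-- An edge with an end in the unit `i` touches the units assigned `false` iff `ω i = false`. -/
lemma DecoBaseE.touches_unitsFalse_iff {ω : Config ι} {i : ι} {e : E} {x y : V}
    (hxy : ends e = s(x, y)) (hx : x ∈ unitAZ A Z i) :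
    e ∈ touches ends (armsFalseC (unitAZ A Z) ω) ↔ ω i = false := by
  constructor
  · rintro ⟨z, ⟨j, hj, hz⟩, w, hzw⟩
    rw [hxy, Sym2.eq_iff] at hzw
    rcases hzw with ⟨h1, _⟩ | ⟨_, h2⟩
    · rw [← h1] at hz
      have hji : j = i := by
        by_contra hne
        exact hb.unit_disj hne hz hx
      rw [← hji]; exact hj
    · rw [← h2] at hz
      have hij : i = j := hb.unit_eq_of_edge hxy hx hz
      rw [hij]; exact hj
  · intro hi
    exact ⟨x, ⟨i, hi, hx⟩, y, hxy⟩

/-- **The value of a realisation on an edge with an end in the unit `i`.** -/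
lemma DecoBaseE.decoRealRR_apply_of_mem {ω : Config (ι ⊕ ↥RR)} {i : ι} {e : E} {x y : V}
    (hxy : ends e = s(x, y)) (hx : x ∈ unitAZ A Z i) :
    decoRealRR ends A Z RR ζ ω e = (if ω (Sum.inl i) = true then ζ e else !ζ e) := by
  rw [decoRealRR_apply_of_notMem_rr (hb.notMem_rr_of_mem_unit hxy hx)]
  by_cases hi : ω (Sum.inl i) = true
  · rw [flip_apply_of_notMem, if_pos hi]
    rw [hb.touches_unitsFalse_iff hxy hx]; simp [armPart, hi]
  · rw [flip_apply_of_mem, if_neg hi]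
    rw [hb.touches_unitsFalse_iff hxy hx]
    simpa [armPart] using hi

omit hb in
/-- The value of a realisation on an edge with no end in a unit and not joining two roots. -/
lemma DecoBaseE.decoRealRR_apply_of_notMem {ω : Config (ι ⊕ ↥RR)} {e : E}
    (he : e ∉ touches ends (allArms (unitAZ A Z))) (hrr : e ∉ RR) :
    decoRealRR ends A Z RR ζ ω e = ζ e := by
  rw [decoRealRR_apply_of_notMem_rr hrr, flip_apply_of_notMem]
  exact fun h' => he (touches_mono (armsFalseC_subset_allArms _) h')

/-- An edge at a root with its other end in `A i` is red at a cube point iff `ω (inl i) = true`. -/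
lemma DecoBaseE.decoRealRR_root_edge {ω : Config (ι ⊕ ↥RR)} {i : ι} {e : E} {r x : V} (hr : r ∈ R)
    (hrx : ends e = s(r, x)) (hx : x ∈ A i) :
    decoRealRR ends A Z RR ζ ω e = true ↔ ω (Sum.inl i) = true := by
  rw [hb.decoRealRR_apply_of_mem (ends_swap hrx) (Or.inl hx), hb.base.root_red e r x hr hrx]
  by_cases hi : ω (Sum.inl i) = true <;> simp [hi]

/-- A root–root edge is red at a cube point iff its coordinate is `true`. -/
lemma DecoBaseE.decoRealRR_rr_edge {ω : Config (ι ⊕ ↥RR)} {e : E} (he : e ∈ RR) :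
    decoRealRR ends A Z RR ζ ω e = true ↔ ω (Sum.inr ⟨e, he⟩) = true := by
  obtain ⟨r, hr, r', hr', hrr⟩ := (hb.base.rr_iff e).1 he
  rw [decoRealRR_apply_rr he, hb.base.root_red e r r' hr hrr]
  by_cases hi : ω (Sum.inr ⟨e, he⟩) = true <;> simp [hi]

/-- An edge from `A i` to the outside of `H` (a decoration vertex, `l`, or a vertex of no unit) is
red at a cube point iff `ω (inl i) = false`. -/
lemma DecoBaseE.decoRealRR_out_edge {ω : Config (ι ⊕ ↥RR)} {i : ι} {e : E} {x y : V}
    (hxy : ends e = s(x, y)) (hx : x ∈ A i) (hy : y ∉ H) :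
    decoRealRR ends A Z RR ζ ω e = true ↔ ω (Sum.inl i) = false := by
  rw [hb.decoRealRR_apply_of_mem hxy (Or.inl hx),
    hb.base.bdry_blue e x y hxy (hb.base.arm_sub i x hx).1 hy]
  by_cases hi : ω (Sum.inl i) = true <;> simp [hi]

/-- A vertex adjacent to a root is a root or lies in an arm (in particular in `H`). -/
lemma DecoBaseE.mem_H_of_adj_root {e : E} {r x : V} (hr : r ∈ R) (hrx : ends e = s(r, x)) :
    x ∈ H := hb.base.mem_H_of_adj_root hr hrx

/-- The route configuration of a unit assigned `false` lies below the realisation. -/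
lemma DecoBaseE.decoRoute_le_decoRealRR {ω : Config (ι ⊕ ↥RR)} {i : ι}
    (hi : ω (Sum.inl i) = false) :
    decoRoute ends (unitAZ A Z i) ζ ≤ decoRealRR ends A Z RR ζ ω := by
  intro e
  by_cases he : decoRoute ends (unitAZ A Z i) ζ e = true
  · rw [he]
    obtain ⟨hζe, x, hx, y, hxy⟩ := decoRoute_eq_true_iff.1 he
    rw [hb.decoRealRR_apply_of_mem hxy hx, if_neg (by simp [hi]), hζe]
    exact le_refl _
  · simp only [Bool.not_eq_true] at he
    rw [he]; exact Bool.false_le _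

/-- The route configuration of a unit assigned `true` lies below the blue realisation. -/
lemma DecoBaseE.decoRoute_le_blue_decoRealRR {ω : Config (ι ⊕ ↥RR)} {i : ι}
    (hi : ω (Sum.inl i) = true) :
    decoRoute ends (unitAZ A Z i) ζ ≤ blue (decoRealRR ends A Z RR ζ ω) := by
  intro e
  by_cases he : decoRoute ends (unitAZ A Z i) ζ e = true
  · rw [he]
    obtain ⟨hζe, x, hx, y, hxy⟩ := decoRoute_eq_true_iff.1 he
    rw [blue_apply, hb.decoRealRR_apply_of_mem hxy hx, if_pos hi, hζe]
    exact le_refl _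
  · simp only [Bool.not_eq_true] at he
    rw [he]; exact Bool.false_le _

/-- **A decoration vertex of a unit assigned `false` lies in the red cluster of `l`.** -/
theorem DecoBaseE.deco_mem_cluster_l_of_false {ω : Config (ι ⊕ ↥RR)} {i : ι}
    (hi : ω (Sum.inl i) = false) {z : V} (hz : z ∈ Z i) :
    z ∈ cluster ends (decoRealRR ends A Z RR ζ ω) l :=
  cluster_mono (hb.decoRoute_le_decoRealRR hi) l (hb.deco_conn i z hz)

/-- **A decoration vertex of a unit assigned `true` lies in the blue cluster of `l`.** -/
theorem DecoBaseE.deco_mem_cluster_blue_l_of_true {ω : Config (ι ⊕ ↥RR)} {i : ι}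
    (hi : ω (Sum.inl i) = true) {z : V} (hz : z ∈ Z i) :
    z ∈ cluster ends (blue (decoRealRR ends A Z RR ζ ω)) l :=
  cluster_mono (hb.decoRoute_le_blue_decoRealRR hi) l (hb.deco_conn i z hz)

end Base

end LocRows

end Summit.Ventures.PercRepro2
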